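import Summits.FinalStateConjecture.FinalStateConjecture.Theorems.PhaseMixingCaptureBulkKerrCaptureC2ScalingDevelopment
import Summits.FinalStateConjecture.FinalStateConjecture.Theorems.PhaseMixingCaptureBulkKerrCaptureC2ScalingData
import Summits.FinalStateConjecture.FinalStateConjecture.Theorems.PhaseMixingCaptureBulkKerrCaptureC2NormalForm
import HarnessLib

/-!
# Crux `PhaseMixingCapture.BulkKerrCaptureC2` (stmt-FinalStateConjecture-14985): MASS NORMALISATION — the crux is
# equivalent to its unit-mass instance

Support file for the crux `BulkKerrCaptureC2` (sub-extremal Kerr capture in the bulk, import grade, `C²` handed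
over).  In block form (`Negative.BlockForm.bulkKerrCaptureC2_iff_captureC2At`) the crux reads
`∀ a₁ < 1, ∃ (s, δ), ∀ M > 0, ∀ η > 0, ∃ ε > 0, ∀ |a| ≤ a₁ M, CaptureC2At s δ M _ ε η a`, with the mass quantified
universally AFTER the regularity/weight `(s, δ)` has been chosen.  The Kerr family is homothetic and the vacuum Einstein
equations are scale covariant, and the two companion files make this precise for the block: the shrink
`D₀ = ((y ↦ l y)^* D).homothety l⁻¹` of a datum `D` on `Kerr.slice (la) (lM)` is a vacuum datum on `Kerr.slice a M`
whose `H^s_δ`-distances to `Kerr.data M a M` (the shrink of `Kerr.data (lM) (la) (lM)`, `shrink_kerrData`) are at most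
`K(l, s, δ)` times those of `D` to `Kerr.data (lM) (la) (lM)` (`…ScalingData`), and the conclusion of the crux for the
maximal developments of `D` follows from that for the maximal developments of `D₀` with the witness and the tolerance
scaled by `l` (`…ScalingDevelopment.conclusion_of_shrink`).  Hence:

* `captureC2At_dilate` — **scale covariance of the block**: `CaptureC2At s δ M _ ε η a` implies
  `CaptureC2At s δ (lM) _ (ε / K) (lη) (la)` for every `l > 0`, with `K = K(l, s, δ)` INDEPENDENT of the spin `a`
  (so that one basin serves all `|a| ≤ a₁ M`);
* `bulkKerrCaptureC2_iff_unitMass` — **`BulkKerrCaptureC2` is equivalent to its unit-mass instance**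
  `∀ a₁ < 1, ∃ (s, δ), ∀ η > 0, ∃ ε > 0, ∀ |a| ≤ a₁, CaptureC2At s δ 1 _ ε η a` (forward: `M := 1`; backward: given
  `M, η`, take the unit-mass basin `ε₁` for the tolerance `η / M` and dilate by `l := M`: `ε := ε₁ / K(M, s, δ)`);
* `bulkKerrCaptureC2_iff_unitMass_locallyUniform` — … and further to LOCALLY UNIFORM (in the spin) `C²` capture around
  each sub-extremal unit-mass Kerr `g_{1,χ}`, `|χ| < 1` (the Lebesgue-number lemma of `…NormalForm` at `M = 1`).

Together with the normal form `…NormalForm` (p106217: the crux is the `(ρ₀, k) = (1, 2)` unit-leaf germ of the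
all-orders claim) this pins the crux to ONE mass: any discharge of the imported claim, or any direct proof, may assume
`M = 1`.  Nothing here closes the crux.  Everything is proved; no definitions, no named facts.
References: R. Bartnik, J. Isenberg, *The constraint equations* (2004), §2 (scale covariance of the constraints);
R. P. Kerr, A. Schild (1965), §2 (homogeneity of the family); H. Ringström (2009), Def. 16.5; R. Bartnik, CPAM 39
(1986), (1.2)–(1.3).
-/

-- the doubled `FinalStateConjecture.FinalStateConjecture` path component trips dupNamespace
set_option linter.dupNamespace false

noncomputable section

open Set Function Topology
open scoped Manifold ContDiff Topology
open Literature.Geometry.Lorentzian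
open Summit.FinalStateConjecture.FinalStateConjecture.Theses.PhaseMixingCapture (BulkKerrCaptureC2)
open Summit.FinalStateConjecture.FinalStateConjecture.Theorems.BulkKerrCaptureC2.Negative
  (CaptureC2At bulkKerrCaptureC2_iff_captureC2At)
open Summit.FinalStateConjecture.FinalStateConjecture.Theorems.BulkKerrCaptureC2.Centre (sliceScale_smooth)
open Summit.FinalStateConjecture.FinalStateConjecture.Theorems.BulkKerrCaptureC2.NormalForm
  (uniform_of_locallyUniform spin_le_of_near_centre)
open Summit.FinalStateConjecture.FinalStateConjecture.Theorems.BulkKerrCapture.Negative (isSubextremal_of_spin_le)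

namespace Summit.FinalStateConjecture.FinalStateConjecture.Theorems.BulkKerrCaptureC2.Scaling

/-! ## §1 Scale covariance of the block `CaptureC2At` -/

section Dilate

variable [Kerr.Facts] [Kerr.SliceFacts] {s : ℕ} {δ l : ℝ}

/-- **Scale covariance of the block of the crux.**  Let `l > 0` and let `K > 0` dominate the `H^s_δ`-distances of
shrinks (`dataWeightedSobolevEDist_shrink_le`: `dist_{s,δ}(D₁⁰, D₂⁰) ≤ K dist_{s,δ}(D₁, D₂)` for all `a, M` and all
data on `Kerr.slice (la) (lM)`).  If `CaptureC2At s δ M _ ε η a` holds, then so does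
`CaptureC2At s δ (lM) _ (ε / K) (lη) (la)`: a b-conormal vacuum datum `D` on `Kerr.slice (la) (lM)` within `ε / K` of
`Kerr.data (lM) (la) (lM)` shrinks to a b-conormal vacuum datum `D₀` on `Kerr.slice a M`
(`isVacuumConstraintSolution_shrink`; all distances to `Kerr.data M a M = shrink of Kerr.data (lM) (la) (lM)`,
`shrink_kerrData`, stay finite) within `ε` of `Kerr.data M a M`; the hypothesis gives the conclusion for the maximal
developments of `D₀`, which descends to those of `D` with witness `(lM', la')` and tolerance `lη`
(`conclusion_of_shrink`).  The equalities `M' = lM`, `a' = la`, `η' = lη`, `ε' = ε / K` enter by `subst`.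
Bartnik–Isenberg 2004, §2; Kerr–Schild 1965, §2; Ringström 2009, Def. 16.5. [cite: BartnikIsenberg2004, §2] -/
theorem captureC2At_dilate (hl : 0 < l) {K : ℝ} (hK : 0 < K)
    (hKd : ∀ (a M : ℝ) (D₁ D₂ : InitialDataSet 𝓘(ℝ, E3) (Kerr.slice (l * a) (l * M))),
      InitialDataSet.dataWeightedSobolevEDist s δ
          ((D₁.comap (Kerr.sliceShrinkHomeomorph l hl a M).symm (sliceScale_smooth hl a M).1
            (sliceScale_smooth hl a M).2).homothety l⁻¹ (inv_pos.2 hl))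
          ((D₂.comap (Kerr.sliceShrinkHomeomorph l hl a M).symm (sliceScale_smooth hl a M).1
            (sliceScale_smooth hl a M).2).homothety l⁻¹ (inv_pos.2 hl)) ≤
        ENNReal.ofReal K * InitialDataSet.dataWeightedSobolevEDist s δ D₁ D₂)
    {M : ℝ} (hM : 0 < M) {ε η a : ℝ} (h : CaptureC2At s δ M hM.le ε η a)
    {M' a' η' ε' : ℝ} (hM'e : M' = l * M) (ha'e : a' = l * a) (hη'e : η' = l * η) (hε'e : ε' = ε / K)
    (hM' : 0 ≤ M') : CaptureC2At s δ M' hM' ε' η' a' := by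
  subst hM'e ha'e hη'e hε'e
  intro D _ hvac hcon hdist 𝒟 hmax
  have hK0 : ENNReal.ofReal K ≠ 0 := (ENNReal.ofReal_pos.2 hK).ne'
  -- the shrink of `D` is a b-conormal vacuum datum in the `ε`-ball about `Kerr.data M a M`
  haveI := ((D.comap (Kerr.sliceShrinkHomeomorph l hl a M).symm (sliceScale_smooth hl a M).1
    (sliceScale_smooth hl a M).2).homothety l⁻¹ (inv_pos.2 hl)).metric.hasLeviCivita
  have hvac₀ := isVacuumConstraintSolution_shrink hl D hvac
  have hcentre := shrink_kerrData (a := a) hM.le hl hM'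
  have hcon₀ : ∀ s' : ℕ, InitialDataSet.dataWeightedSobolevEDist s' δ
      ((D.comap (Kerr.sliceShrinkHomeomorph l hl a M).symm (sliceScale_smooth hl a M).1
        (sliceScale_smooth hl a M).2).homothety l⁻¹ (inv_pos.2 hl)) (Kerr.data M a M hM.le) < ⊤ := by
    intro s'
    obtain ⟨K', -, hK'⟩ := dataWeightedSobolevEDist_shrink_le hl s' δ
    have h1 := hK' a M D (Kerr.data (l * M) (l * a) (l * M) hM')
    rw [hcentre] at h1
    exact h1.trans_lt (ENNReal.mul_lt_top ENNReal.ofReal_lt_top (hcon s'))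
  have hdist₀ : InitialDataSet.dataWeightedSobolevEDist s δ
      ((D.comap (Kerr.sliceShrinkHomeomorph l hl a M).symm (sliceScale_smooth hl a M).1
        (sliceScale_smooth hl a M).2).homothety l⁻¹ (inv_pos.2 hl)) (Kerr.data M a M hM.le) <
      ENNReal.ofReal ε := by
    have h1 := hKd a M D (Kerr.data (l * M) (l * a) (l * M) hM')
    rw [hcentre] at h1
    refine h1.trans_lt ?_
    calc ENNReal.ofReal K * InitialDataSet.dataWeightedSobolevEDist s δ D (Kerr.data (l * M) (l * a) (l * M) hM')
        < ENNReal.ofReal K * ENNReal.ofReal (ε / K) :=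
          ENNReal.mul_lt_mul_right hK0 ENNReal.ofReal_ne_top hdist
      _ = ENNReal.ofReal ε := by
          rw [← ENNReal.ofReal_mul hK.le, mul_div_cancel₀ _ hK.ne']
  -- the conclusion for the maximal developments of the shrink descends to those of `D`
  exact conclusion_of_shrink hM.le hl D (fun 𝒟₀ h₀ ↦ h _ hvac₀ hcon₀ hdist₀ 𝒟₀ h₀) 𝒟 hmax

end Dilate

/-! ## §2 The crux is equivalent to its unit-mass instance -/

/-- **Mass normalisation of the crux: `BulkKerrCaptureC2` is equivalent to its unit-mass instance.**  In block
form the crux is `∀ a₁ < 1, ∃ (s, δ), ∀ M > 0, ∀ η > 0, ∃ ε > 0, ∀ |a| ≤ a₁ M, CaptureC2At s δ M _ ε η a`; it is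
equivalent to the same statement at the single mass `M = 1`.  Forward: specialise.  Backward: given `(s, δ)` from the
unit-mass statement and `M > 0`, `η > 0`, let `ε₁` be the unit-mass basin for the tolerance `η / M` and `K = K(M, s, δ)`
the distance constant of the shrink by `l := M` (`dataWeightedSobolevEDist_shrink_le`, independent of the spin); then
`ε := ε₁ / K` works for every `|a| ≤ a₁ M`, by `captureC2At_dilate` at the unit-mass spin `a / M`
(`M = M · 1`, `a = M (a / M)`, `η = M (η / M)`).  Bartnik–Isenberg 2004, §2 (scale covariance of the Cauchy problem
for the vacuum Einstein equations); Kerr–Schild 1965, §2. [cite: BartnikIsenberg2004, §2] -/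
theorem bulkKerrCaptureC2_iff_unitMass :
    BulkKerrCaptureC2 ↔
      ∀ [Kerr.Facts] [Kerr.SliceFacts], ∀ a₁ : ℝ, a₁ < 1 → ∃ (s : ℕ) (δ : ℝ), ∀ η > (0 : ℝ), ∃ ε > (0 : ℝ),
        ∀ a : ℝ, |a| ≤ a₁ → CaptureC2At s δ 1 zero_le_one ε η a := by
  rw [bulkKerrCaptureC2_iff_captureC2At]
  constructor
  · intro h _ _ a₁ ha₁
    obtain ⟨s, δ, H⟩ := h a₁ ha₁
    refine ⟨s, δ, fun η hη ↦ ?_⟩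
    obtain ⟨ε, hε, Hε⟩ := H 1 one_pos η hη
    refine ⟨ε, hε, fun a ha ↦ ?_⟩
    have ha' : |a| ≤ a₁ * 1 := by rwa [mul_one]
    exact Hε a ha'
  · intro h _ _ a₁ ha₁
    obtain ⟨s, δ, H⟩ := h a₁ ha₁
    refine ⟨s, δ, fun M hM η hη ↦ ?_⟩
    obtain ⟨ε₁, hε₁, H₁⟩ := H (η / M) (div_pos hη hM)
    obtain ⟨K, hK, hKd⟩ := dataWeightedSobolevEDist_shrink_le hM s δ
    refine ⟨ε₁ / K, div_pos hε₁ hK, fun a ha ↦ ?_⟩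
    have ha' : |a / M| ≤ a₁ := by
      rwa [abs_div, abs_of_pos hM, div_le_iff₀ hM]
    exact captureC2At_dilate hM hK hKd one_pos (H₁ (a / M) ha') (mul_one M).symm
      (mul_div_cancel₀ a hM.ne').symm (mul_div_cancel₀ η hM.ne').symm rfl hM.le

/-- **The sharpest normal form: the crux is LOCALLY UNIFORM `C²` capture around each sub-extremal UNIT-MASS Kerr.**
`BulkKerrCaptureC2` holds iff around every normalised centre `χ ∈ (−1, 1)` there are exponents `(s, δ)`, a spin radius
`ς > 0` and, per tolerance `η > 0`, one basin `ε > 0` such that `CaptureC2At s δ 1 _ ε η a` holds for every sub-extremal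
spin `a` with `|a − χ| < ς` — the mass pinned to `1` (`bulkKerrCaptureC2_iff_unitMass`) AND the compact spin range
localised (the Lebesgue-number lemma `NormalForm.uniform_of_locallyUniform`, run on the predicate
`Good s δ M _ η ε a := CaptureC2At s δ 1 _ ε η (a / M)`).  This is exactly the shape in which a stability theorem
of ONE Kerr black hole `g_{1,χ}` with constants locally uniform in the spin (Hintz 2026, Thm. 13.1 + Rem. 13.2 at
`M = 1`) would be consumed. [folklore] -/
theorem bulkKerrCaptureC2_iff_unitMass_locallyUniform :
    BulkKerrCaptureC2 ↔
      ∀ [Kerr.Facts] [Kerr.SliceFacts], ∀ χ : ℝ, |χ| < 1 → ∃ (s : ℕ) (δ : ℝ), ∃ ς > (0 : ℝ), ∀ η > (0 : ℝ),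
        ∃ ε > (0 : ℝ), ∀ a : ℝ, |a - χ| < ς → Kerr.IsSubextremal 1 a → CaptureC2At s δ 1 zero_le_one ε η a := by
  rw [bulkKerrCaptureC2_iff_unitMass]
  constructor
  · intro h _ _ χ hχ
    have ha₁ : (1 + |χ|) / 2 < 1 := by linarith
    obtain ⟨s, δ, H⟩ := h ((1 + |χ|) / 2) ha₁
    refine ⟨s, δ, (1 - |χ|) / 2, by linarith, fun η hη ↦ ?_⟩
    obtain ⟨ε, hε, Hε⟩ := H η hη
    refine ⟨ε, hε, fun a ha _ ↦ Hε a ?_⟩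
    have h1 := spin_le_of_near_centre (M := 1) (a := a) one_pos (by rwa [div_one])
    rwa [mul_one] at h1
  · intro h _ _
    -- the Lebesgue-number lemma on the unit-mass block read at the normalised spin `a / M`
    have key := uniform_of_locallyUniform (fun s δ M _ η ε a ↦ CaptureC2At s δ 1 zero_le_one ε η (a / M))
      (fun hs hδ hε hg ↦ hg.mono hs hδ hε le_rfl) fun χ hχ ↦ by
        obtain ⟨s, δ, ς, hς, H⟩ := h χ hχ
        refine ⟨s, δ, min ς ((1 - |χ|) / 2), lt_min hς (by linarith), fun M hM η hη ↦ ?_⟩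
        obtain ⟨ε, hε, Hε⟩ := H η hη
        refine ⟨ε, hε, fun a ha ↦ Hε (a / M) (ha.trans_le (min_le_left _ _)) ?_⟩
        have h1 := spin_le_of_near_centre (M := 1) (a := a / M) one_pos
          (by rw [div_one]; exact ha.trans_le (min_le_right _ _))
        exact isSubextremal_of_spin_le (a₁ := (1 + |χ|) / 2) (by linarith) one_pos h1
    intro a₁ ha₁
    obtain ⟨s, δ, H⟩ := key a₁ ha₁
    refine ⟨s, δ, fun η hη ↦ ?_⟩
    obtain ⟨ε, hε, Hε⟩ := H 1 one_pos η hη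
    refine ⟨ε, hε, fun a ha ↦ ?_⟩
    have h1 := Hε a (by rwa [mul_one])
    rwa [div_one] at h1

/-- **Registered sub-goal `stub_bulkKerrCaptureC2_iff_unitMass`** (crux item stmt-FinalStateConjecture-14985): the
mass normalisation of the crux, closed form of `bulkKerrCaptureC2_iff_unitMass`. [cite: BartnikIsenberg2004, §2] -/
theorem stub_bulkKerrCaptureC2_iff_unitMass : BulkKerrCaptureC2 ↔ ∀ [Kerr.Facts] [Kerr.SliceFacts], ∀ a₁ : ℝ, a₁ < 1 → ∃ (s : ℕ) (δ : ℝ), ∀ η > (0 : ℝ), ∃ ε > (0 : ℝ), ∀ a : ℝ, |a| ≤ a₁ → CaptureC2At s δ 1 zero_le_one ε η a :=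
  bulkKerrCaptureC2_iff_unitMass

end Summit.FinalStateConjecture.FinalStateConjecture.Theorems.BulkKerrCaptureC2.Scaling

end
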